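import Literature.AlgebraicGeometry.Frobenioids.DivSlimExample
import Literature.AlgebraicGeometry.Frobenioids.NonPreservationOfUnits
import Literature.AlgebraicGeometry.Frobenioids.OneObjectAutForget
import Literature.AlgebraicGeometry.Frobenioids.BaseCategoryTheoreticityDefs
import Literature.AlgebraicGeometry.Frobenioids.DivisorMonoidCategoryTheoreticityDefs
import Literature.AlgebraicGeometry.Frobenioids.PreFrobenioidDataOfFunctor
import HarnessLib

/-!
# Frobenioids I, Examples 3.8/3.9/4.7 (ii) and Remark 4.11.2: the slimness conclusions PROVED

Mochizuki, *The geometry of Frobenioids I: the general theory*, Kyushu J. Math. **62** (2008)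
293–400, kurims text p. 71 (Ex. 3.8), p. 72 (Ex. 3.9), pp. 87–88 (Ex. 4.7 (ii)), p. 94 (Rem. 4.11.2)
[cite: MochizukiFrdI2008, Ex. 4.7 (ii) pp.87-88]. PROOF-ONLY companion of the statement files
`RationalSemidirectBase.lean`, `NonPreservationOfUnits.lean`, `DivSlimExample.lean` (seat
abc-iut-L1-t8), which left these conclusions untyped because [FrdI] Def. 3.1 (i) "Frobenius-slim"
(`IsFrobeniusSlim`, seat abc-iut-L1-t3, `BaseCategoryTheoreticityDefs.lean`) and Def. 4.5 (iv) "Div-slim"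
(`PreFrobenioidData.IsDivSlim`, `DivisorMonoidCategoryTheoreticityDefs.lean`) had not landed then.

PROVED here:
* a one-object category `B(G)` of a group `G` receiving an injection of monoids `𝔽 ↪ G` is NOT
  Frobenius-slim (`not_isFrobeniusSlim_singleObj_of_injective`; `Aut(D_A → D) ≅ G` is
  `SingleObjAut.autForgetMulEquiv`); hence "`D` fails to be Frobenius-slim" for the base
  `D = B(ℚ ⋊ N)` of Examples 3.8/3.9 (p. 71 l. −14, p. 72 l. 6: `RatSemidirect.not_isFrobeniusSlim_D`) and
  for the base `D = B(V ⋊ N)` of Example 4.7 (ii) (p. 87: `Ex47ii.not_isFrobeniusSlim_D`);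
* Example 4.7 (ii), p. 88 l. 1: "`D` is Div-slim [relative to `Φ`]" for `Φ = ⨁_{g ∈ G} ℤ_{≥0}`
  (`Ex47ii.isDivSlim`: for the operations of ANY pre-Frobenioid structure `C → F_Φ` over `(D, Φ)`, whose
  divisor-monoid data is `Φ`);
* Remark 4.11.2, first half (p. 94): in Example 3.9 "since the subgroup `U` of `G = Aut(D_A → D)` acts
  trivially on `V × W`, it follows that `D` fails to be Div-slim" (`Ex39.not_isDivSlim`, again for any
  `C → F_Φ` over `(D, Φ)`; and the same for `Φ^char`, `Ex39.not_isDivSlim_char`, the divisor monoid of the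
  Frobenioid `C = F_Φ → F_{Φ^char}`).
No statement of the paper is strengthened; nothing here takes a side on [IUTchIII] Cor. 3.12.
-/

namespace Literature.AlgebraicGeometry.Frobenioids

open CategoryTheory Opposite

/-! ### One-object bases receiving `𝔽 ↪ G` are not Frobenius-slim -/

/-- If a group `G` receives an injective homomorphism of monoids `𝔽 ↪ G`, then the one-object category
`B(G)` is not Frobenius-slim: composing with `Aut(D_A → D) ≅ G` gives `𝔽 → Aut(D_A → D)` that is
injective, hence does not factor through `𝔽 ↠ N_{≥1}` (which identifies `γ = (1,1)` and `1`)
(FrdI Ex. 3.8 p. 71: "since there exist injections of monoids `𝔽 ↪ G`, it thus follows that `D` fails to be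
Frobenius-slim"). [cite: MochizukiFrdI2008, Ex. 3.8 p.71] -/
theorem not_isFrobeniusSlim_singleObj_of_injective (G : Type) [Group G] (f : StandardFrobenioid →* G)
    (hf : Function.Injective f) : ¬ IsFrobeniusSlim (SingleObj G) := by
  intro h
  let e : Aut (Over.forget (SingleObj.star G)) ≃* G := SingleObjAut.autForgetMulEquiv G
  obtain ⟨g, hg⟩ := h.factors (SingleObj.star G) (e.symm.toMonoidHom.comp f)
  have h1 : e.symm (f StandardFrobenioid.gen) = e.symm (f 1) := by
    have := DFunLike.congr_fun hg StandardFrobenioid.gen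
    rw [MonoidHom.comp_apply, MonoidHom.comp_apply] at this
    change e.symm (f StandardFrobenioid.gen) = g (StandardFrobenioid.degHom StandardFrobenioid.gen) at this
    rw [this, map_one, map_one]
    show g 1 = 1
    exact map_one g
  have h2 : StandardFrobenioid.gen = 1 := hf (e.symm.injective h1)
  have h3 := congrArg (fun x : StandardFrobenioid => Multiplicative.toAdd x.div) h2
  simp [StandardFrobenioid.gen] at h3

namespace RatSemidirect

/-- **Examples 3.8 / 3.9**: "since there exist injections of monoids `𝔽 ↪ G`, it thus follows that `D` fails
to be Frobenius-slim" (FrdI p. 71, and "[cf. Example 3.8] `D` fails to be Frobenius-slim", p. 72) — PROVED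
for `D = B(G)`, `G = ℚ ⋊ N`, via the injection `frobToG` of `RationalSemidirectBase.lean`.
[cite: MochizukiFrdI2008, Ex. 3.8 p.71] -/
theorem not_isFrobeniusSlim_D : ¬ IsFrobeniusSlim D :=
  not_isFrobeniusSlim_singleObj_of_injective G frobToG frobToG_injective

end RatSemidirect

namespace Ex47ii

/-- **Example 4.7 (ii)**: "clearly there exists an injection `𝔽 ↪ G`, so `D` fails to be Frobenius-slim"
(FrdI p. 87) — PROVED for `D = B(V ⋊ N)` via `Ex47ii.frobToG`. [cite: MochizukiFrdI2008, Ex. 4.7 (ii) p.87] -/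
theorem not_isFrobeniusSlim_D : ¬ IsFrobeniusSlim D :=
  not_isFrobeniusSlim_singleObj_of_injective G frobToG frobToG_injective

/-- **Example 4.7 (ii)**: "the natural map `Aut(D_A → D) = G → Aut(D_A → Mon)` is clearly injective, so `D`
is Div-slim [relative to `Φ`]" (FrdI pp. 87–88) — PROVED, for the operations of any pre-Frobenioid
structure `F : C → F_Φ` over `(D, Φ)` (whose divisor monoid and pull-backs are those of `Φ`): an
automorphism of `D_A → D` corresponds to `c ∈ G` (`autForgetMulEquiv`); if its component at `(A, id)`
acts trivially on `Φ` then `Φ(c) = id = Φ(1)`, so `c = 1` by `act_injective`.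
[cite: MochizukiFrdI2008, Ex. 4.7 (ii) p.88] -/
theorem isDivSlim {C : Type*} [Category C] (F : C ⥤ ElemFrobenioid Φ) :
    (PreFrobenioidData.ofFunctor Φ F).IsDivSlim := by
  refine ⟨fun A α hα => ?_⟩
  let e : Aut (Over.forget (SingleObj.star G)) ≃* G := SingleObjAut.autForgetMulEquiv G
  have hc : act (e α) = act 1 := by
    rw [act_one]
    refine MonoidHom.ext fun x => ?_
    exact hα (Over.mk (𝟙 (SingleObj.star G))) x
  have hc1 : e α = 1 := act_injective hc
  exact e.injective (hc1.trans (map_one e).symm)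

end Ex47ii

namespace Ex39

open RatSemidirect

/-- Conjugates of elements of `U` lie in `U`: `(g⁻¹ · (u,1) · g).n = 1`. [cite: MochizukiFrdI2008, Rem. 4.11.2 p.94] -/
theorem conj_inU_n (g : G) (u : ℚ) : (g⁻¹ * inU u * g).n = 1 := by
  have hinv : (g⁻¹).n = g.n⁻¹ := rfl
  simp [inU, hinv]

/-- An element of `G` with trivial `N`-coordinate acts trivially on `V × W`. [cite: MochizukiFrdI2008, Rem. 4.11.2 p.94] -/
theorem act_eq_id_of_n_eq_one {g : G} (hg : g.n = 1) : act g = MonoidHom.id _ := by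
  have : g = inU g.u := G.ext rfl hg
  rw [this]
  exact act_inU g.u

/-- **Remark 4.11.2**, first half: "in Example 3.9, since the subgroup `U` of `G = Aut(D_A → D)` … acts
trivially on `V × W`, it follows that `D` fails to be Div-slim" (FrdI p. 94) — PROVED, relative to `Φ`
(for the operations of any `F : C → F_Φ` over `(D, Φ)`): the automorphism of `D_A → D` attached to
`(1, 1) ∈ U` has components the conjugates `g⁻¹ (1,1) g ∈ U`, all acting trivially, and is `≠ 1`.
[cite: MochizukiFrdI2008, Rem. 4.11.2 p.94] -/
theorem not_isDivSlim {C : Type*} [Category C] (F : C ⥤ ElemFrobenioid Φ) :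
    ¬ (PreFrobenioidData.ofFunctor Φ F).IsDivSlim := by
  intro h
  let e : Aut (Over.forget (SingleObj.star G)) ≃* G := SingleObjAut.autForgetMulEquiv G
  have h1 : e.symm (inU 1) = 1 := by
    refine h.eq_one (SingleObj.star G) (e.symm (inU 1)) fun B x => ?_
    have hB : SingleObjAut.elt G ((e.symm (inU 1)).hom.app B) =
        (SingleObjAut.elt G B.hom)⁻¹ * inU 1 * SingleObjAut.elt G B.hom :=
      SingleObjAut.familyOf_app G (inU 1) B
    show act (SingleObjAut.elt G ((e.symm (inU 1)).hom.app B)) x = x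
    rw [hB, act_eq_id_of_n_eq_one (conj_inU_n _ 1)]
    rfl
  have h2 : inU 1 = 1 := by
    have := congrArg e h1
    rwa [MulEquiv.apply_symm_apply, map_one] at this
  have h3 := congrArg G.u h2
  simp [inU] at h3

/-- The same relative to `Φ^char` (the divisor monoid of the Frobenioid `C = F_Φ → F_{Φ^char}` of
Example 3.9): `U` acts trivially on `Φ^char` as well, so `D` is not Div-slim relative to `Φ^char` either.
[cite: MochizukiFrdI2008, Rem. 4.11.2 p.94] -/
theorem not_isDivSlim_char {C : Type*} [Category C] (F : C ⥤ ElemFrobenioid (charFunctor Φ)) :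
    ¬ (PreFrobenioidData.ofFunctor (charFunctor Φ) F).IsDivSlim := by
  intro h
  let e : Aut (Over.forget (SingleObj.star G)) ≃* G := SingleObjAut.autForgetMulEquiv G
  have h1 : e.symm (inU 1) = 1 := by
    refine h.eq_one (SingleObj.star G) (e.symm (inU 1)) fun B x => ?_
    have hB : SingleObjAut.elt G ((e.symm (inU 1)).hom.app B) =
        (SingleObjAut.elt G B.hom)⁻¹ * inU 1 * SingleObjAut.elt G B.hom :=
      SingleObjAut.familyOf_app G (inU 1) B
    obtain ⟨y, rfl⟩ := Associates.mk_surjective x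
    show associatesMap (act (SingleObjAut.elt G ((e.symm (inU 1)).hom.app B))) (Associates.mk y) =
      Associates.mk y
    rw [hB, act_eq_id_of_n_eq_one (conj_inU_n _ 1), associatesMap_mk]
    rfl
  have h2 : inU 1 = 1 := by
    have := congrArg e h1
    rwa [MulEquiv.apply_symm_apply, map_one] at this
  have h3 := congrArg G.u h2
  simp [inU] at h3

end Ex39

end Literature.AlgebraicGeometry.Frobenioids
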